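import Summits.Ventures.DiscreteObjects.PP12.OrderThirteenOmSearch
import Summits.Ventures.DiscreteObjects.PP12.OrderThirteenShapeBits

/-!
# PP(12), order-13 cell: soundness of the kernel enumeration of doubly lexical orbit matrices, I — base-256 packing, packed rows and tests, tie masks, the invariant (definitions)
Framing: lottery ticket; floor = certified bounds/negative ranges.

Cell pub-namedobj (venture DiscreteObjects), target (M). Text: designs gen 21 (`OrderThirteenOmSearchSound`, verified rc 0 as one file); split into four modules `OrderThirteenOmSoundPack` / `…Walk` / `…Search` / `…First` by designs gen 22 for the gate's 400-line rule (declarations and proofs unchanged).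
Here: `pack` arithmetic (field reading without carries, bits), the packed record `rowR` of a true row (`rv`, `g`, `v`), the packed tests read on true data (`ipOK_rowR`: the inner
product is one multiplication; `colLeOK_pack`, `colDoneOK_pack`, `gramOK_pack`), the tie masks (`tieOK_rowR`, `testBit_newTied`), and the DEFINITIONS `TrueMat` (what the search uses about
the orbit matrix), `keyM`, the search invariant `Inv`, `GoodSt`, `GoodChunk` (proved about in `OrderThirteenOmSoundSearch` / `…First`). No `sorry`, no new axioms; nothing here asserts a census statement.
-/

namespace Summit.Ventures.DiscreteObjects.PP12

namespace Om13

open Finset Shape13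

/-- `Σ_{i<n} F i · 256^i` -/
def pack (F : ℕ → ℕ) : ℕ → ℕ | 0 => 0 | n + 1 => pack F n + F n * 256 ^ n
/-- `pack` as a sum -/
theorem pack_eq_sum (F : ℕ → ℕ) (n : ℕ) : pack F n = ∑ i ∈ range n, F i * 256 ^ i := by induction n with | zero => simp [pack] | succ n ih => rw [pack, ih, sum_range_succ]
/-- `pack` depends only on the fields below `n` -/
theorem pack_congr {F G : ℕ → ℕ} {n : ℕ} (h : ∀ i < n, F i = G i) : pack F n = pack G n := by rw [pack_eq_sum, pack_eq_sum]; exact sum_congr rfl fun i hi => (by rw [h i (mem_range.1 hi)])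
/-- a packing with small fields is below `256^n` -/
theorem pack_lt {F : ℕ → ℕ} {n : ℕ} (h : ∀ i < n, F i < 256) : pack F n < 256 ^ n := by
  induction n with
  | zero => simp [pack]
  | succ n ih =>
    rw [pack, pow_succ]
    have h1 := ih fun i hi => h i (by omega)
    have h2 : F n ≤ 255 := (by have := h n (by omega); omega)
    calc pack F n + F n * 256 ^ n < 256 ^ n + 255 * 256 ^ n := by
          have := Nat.mul_le_mul_right (256 ^ n) h2; omega
      _ = 256 ^ n * 256 := (by ring)
/-- packing is additive in the fields -/
theorem pack_add (F G : ℕ → ℕ) (n : ℕ) : pack F n + pack G n = pack (fun i => F i + G i) n := by induction n with | zero => simp [pack] | succ n ih => simp only [pack]; rw [← ih]; ring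
/-- packing commutes with finite sums of field vectors -/
theorem sum_pack {ι : Type*} (s : Finset ι) (F : ι → ℕ → ℕ) (n : ℕ) : ∑ x ∈ s, pack (F x) n = pack (fun i => ∑ x ∈ s, F x i) n := by induction n with | zero => simp [pack] | succ n ih => simp only [pack, sum_add_distrib, ih, sum_mul]
/-- the lowest field first -/
theorem pack_succ' (F : ℕ → ℕ) (n : ℕ) : pack F (n + 1) = F 0 + 256 * pack (fun i => F (i + 1)) n := by induction n with | zero => simp [pack] | succ n ih => rw [pack, ih, pack]; ring
/-- splitting a packing at field `k` -/
theorem pack_split (F : ℕ → ℕ) (k m : ℕ) : pack F (k + m) = pack F k + 256 ^ k * pack (fun i => F (k + i)) m := by induction m with | zero => simp [pack] | succ m ih => rw [Nat.add_succ, pack, ih, pack, pow_add]; ring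
/-- **reading a field**: with all fields `< 256`, field `k` of the packing is `F k` -/
theorem pack_div_mod {F : ℕ → ℕ} {n k : ℕ} (h : ∀ i < n, F i < 256) (hk : k < n) : pack F n / 256 ^ k % 256 = F k := by obtain ⟨m, rfl⟩ : ∃ m, n = k + (m + 1) := ⟨n - k - 1, by omega⟩; rw [pack_split, pack_succ']; have hlow : pack F k < 256 ^ k := pack_lt fun i hi => h i (by omega); rw [show pack F k + 256 ^ k * (F (k + 0) + 256 * pack (fun i => F (k + (i + 1))) m) = pack F k + 256 ^ k * (F k + 256 * pack (fun i => F (k + (i + 1))) m) by simp]; rw [Nat.add_mul_div_left _ _ (by positivity), Nat.div_eq_of_lt hlow, zero_add, Nat.add_mul_mod_self_left]; exact Nat.mod_eq_of_lt (h k (by omega))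
/-- fields beyond `n` vanish -/
theorem pack_div_of_le {F : ℕ → ℕ} {n k : ℕ} (h : ∀ i < n, F i < 256) (hk : n ≤ k) : pack F n / 256 ^ k = 0 := Nat.div_eq_of_lt (lt_of_lt_of_le (pack_lt h) (Nat.pow_le_pow_right (by norm_num) hk))
/-- the bits of a packing with small fields: bit `8k + b` (`b < 8`) is bit `b` of field `k` -/
theorem testBit_pack {F : ℕ → ℕ} {n : ℕ} (h : ∀ i < n, F i < 256) (j : ℕ) : (pack F n).testBit j = if j / 8 < n then (F (j / 8)).testBit (j % 8) else false := by have hj : j = 8 * (j / 8) + j % 8 := (Nat.div_add_mod j 8).symm; have hb : j % 8 < 8 := Nat.mod_lt _ (by norm_num); have e1 : (pack F n).testBit j = (pack F n / 256 ^ (j / 8)).testBit (j % 8) := (by (conv_lhs => rw [hj]); rw [← Nat.testBit_shiftRight, Nat.shiftRight_eq_div_pow, pow_mul, show (2:ℕ) ^ 8 = 256 by norm_num]); rw [e1]; split_ifs with hk; (have e2 := Nat.testBit_mod_two_pow (pack F n / 256 ^ (j / 8)) 8 (j % 8); rw [show (2:ℕ) ^ 8 = 256 by norm_num, pack_div_mod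 h hk] at e2; rw [e2]; simp [hb]); (rw [pack_div_of_le h (by omega), Nat.zero_testBit])
/-- scaling a packing -/
theorem mul_pack (c : ℕ) (F : ℕ → ℕ) (n : ℕ) : c * pack F n = pack (fun i => c * F i) n := by induction n with | zero => simp [pack] | succ n ih => rw [pack, pack, mul_add, ih, mul_assoc]
/-- a packing of `11·B` fields in blocks of `11` -/
theorem pack_blocks (F : ℕ → ℕ) (B : ℕ) : pack F (11 * B) = ∑ b ∈ range B, 256 ^ (11 * b) * pack (fun a => F (11 * b + a)) 11 := by induction B with | zero => simp [pack] | succ B ih => rw [Nat.mul_succ, pack_split, ih, sum_range_succ]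
/-- a row (or column) function extended by `0` beyond `11` -/
def ext (f : Fin 11 → ℕ) (i : ℕ) : ℕ := if h : i < 11 then f ⟨i, h⟩ else 0
/-- `ext` below `11` -/
theorem ext_of_lt (f : Fin 11 → ℕ) {i : ℕ} (h : i < 11) : ext f i = f ⟨i, h⟩ := dif_pos h
/-- the packed record of a row function -/
def rowR (f : Fin 11 → ℕ) : Row := rowOf (List.ofFn f)
/-- generic: `rvalOf` of a tabulated list is the little-endian packing -/
theorem rvalOf_ofFn {n : ℕ} (f : Fin n → ℕ) : rvalOf (List.ofFn f) = pack (fun i => if h : i < n then f ⟨i, h⟩ else 0) n := by induction n with | zero => simp [rvalOf, pack] | succ n ih => (rw [List.ofFn_succ, rvalOf, ih, pack_succ']; congr 1; congr 1; apply pack_congr; intro i hi; simp [hi, Nat.succ_lt_succ hi])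
/-- `rv` of a row function -/
theorem rv_rowR (f : Fin 11 → ℕ) : (rowR f).rv = pack (ext f) 11 := rvalOf_ofFn f
/-- generic: `wvalOf` of a tabulated list -/
theorem wvalOf_ofFn {n : ℕ} (f : Fin n → ℕ) : wvalOf (List.ofFn f) = ∑ b ∈ range n, (if h : b < n then f ⟨b, h⟩ else 0) * 256 ^ (11 * b) := by induction n with | zero => simp [wvalOf] | succ n ih => (rw [List.ofFn_succ, wvalOf, ih, sum_range_succ']; simp only [Nat.zero_lt_succ, dif_pos, mul_zero, pow_zero, mul_one, Fin.zero_eta]; rw [add_comm]; congr 1; rw [mul_sum]; apply sum_congr rfl; intro b hb; have hb' := mem_range.1 hb; simp only [hb', Nat.succ_lt_succ hb', dif_pos, Fin.succ_mk]; rw [show 256 ^ (11 * (b + 1)) = 256 ^ (11 * b) * 309485009821345068724781056 by rw [Nat.mul_succ, pow_add]; norm_num]; ring)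
/-- `g` of a row function is the packed outer product -/
theorem g_rowR (f : Fin 11 → ℕ) : (rowR f).g = pack (fun i => ext f (i % 11) * ext f (i / 11)) 121 := by show rvalOf (List.ofFn f) * wvalOf (List.ofFn f) = _; rw [rvalOf_ofFn, wvalOf_ofFn, mul_sum, show (121 : ℕ) = 11 * 11 from rfl, pack_blocks]; apply sum_congr rfl; intro b hb; have hb' := mem_range.1 hb; rw [show pack (fun i => if h : i < 11 then f ⟨i, h⟩ else 0) 11 * ((if h : b < 11 then f ⟨b, h⟩ else 0) * 256 ^ (11 * b)) = 256 ^ (11 * b) * ((if h : b < 11 then f ⟨b, h⟩ else 0) * pack (fun i => if h : i < 11 then f ⟨i, h⟩ else 0) 11) by ring, mul_pack]; congr 1; apply pack_congr; intro a ha; have e1 : (11 * b + a) % 11 = a := (by omega); have e2 : (11 * b + a) / 11 = b := (by omega); rw [e1, e2, ext, ext, mul_comm]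
/-- generic: `valOf` with an accumulator -/
theorem valOf_acc (acc : ℕ) (l : List ℕ) : valOf acc l = acc * 256 ^ l.length + valOf 0 l := by induction l generalizing acc with | nil => simp [valOf] | cons d ds ih => rw [valOf, ih, List.length_cons, pow_succ, valOf, ih (0 * 256 + d)]; ring
/-- generic: `valOf` of a tabulated list is the big-endian packing -/
theorem valOf_ofFn {n : ℕ} (f : Fin n → ℕ) : valOf 0 (List.ofFn f) = ∑ j ∈ range n, (if h : j < n then f ⟨j, h⟩ else 0) * 256 ^ (n - 1 - j) := by induction n with | zero => simp [valOf] | succ n ih => (rw [List.ofFn_succ, valOf, valOf_acc, ih, List.length_ofFn, sum_range_succ']; simp only [zero_mul, zero_add, Nat.zero_lt_succ, dif_pos, Fin.zero_eta, Nat.sub_zero, Nat.add_sub_cancel]; rw [add_comm]; congr 1; apply sum_congr rfl; intro j hj; have hj' := mem_range.1 hj; simp only [hj', Nat.succ_lt_succ hj', dif_pos, Fin.succ_mk]; congr 2; omega)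
/-- `v` of a row function: field `i` holds entry `10 − i` -/
theorem v_rowR (f : Fin 11 → ℕ) : (rowR f).v = pack (fun i => ext f (10 - i)) 11 := by show valOf 0 (List.ofFn f) = _; rw [valOf_ofFn, pack_eq_sum, ← sum_range_reflect]; apply sum_congr rfl; intro i hi; have hi' := mem_range.1 hi; rw [ext, show 11 - 1 - (11 - 1 - i) = i by omega]
/-- `x &&& 255 = x % 256` -/
theorem land_255 (x : ℕ) : Nat.land x 255 = x % 256 := by apply Nat.eq_of_testBit_eq; intro i; rw [Shape13.land_def, Nat.testBit_land, show (255 : ℕ) = 2 ^ 8 - 1 from rfl, Nat.testBit_two_pow_sub_one, show (256 : ℕ) = 2 ^ 8 from rfl, Nat.testBit_mod_two_pow, Bool.and_comm]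
/-- the low part of the product of two packed rows: a numeral bound -/
theorem lowC_lt : 16 * (∑ i ∈ range 11, ∑ k ∈ range 11, if i + k < 10 then 256 ^ (i + k) else 0) < 256 ^ 10 := by simp only [sum_range_succ, sum_range_zero]; norm_num
/-- **the inner product is one multiplication**: rows with entries `≤ 4` and inner product `12` pass `ipOK` -/
theorem ipOK_rowR {f f' : Fin 11 → ℕ} (hf : ∀ t, f t ≤ 4) (hf' : ∀ t, f' t ≤ 4) (h : ∑ t, f t * f' t = 12) : ipOK (rowR f) (rowR f') = true := by unfold ipOK; rw [v_rowR, rv_rowR, Shape13.beq_eq_decide, decide_eq_true_eq, Shape13.shiftRight_def, Nat.shiftRight_eq_div_pow, show (2 : ℕ) ^ 80 = 256 ^ 10 by norm_num, land_255, pack_eq_sum, pack_eq_sum, sum_mul_sum]; have hA : ∀ i, ext f (10 - i) ≤ 4 := fun i => (by simp only [ext]; split_ifs <;> simp [hf]); have hB : ∀ k, ext f' k ≤ 4 := fun k => (by simp only [ext]; split_ifs <;> simp [hf']); have hsplit : ∀ i k, ext f (10 - i) * 256 ^ i * (ext f' k * 256 ^ k) = (if i + k < 10 then ext f (10 - i)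 * ext f' k * 256 ^ (i + k) else 0) + ((if i + k = 10 then ext f (10 - i) * ext f' k else 0) * 256 ^ 10 + (if 10 < i + k then ext f (10 - i) * ext f' k * 256 ^ (i + k - 11) else 0) * 256 ^ 11) := (by intro i k; rcases lt_trichotomy (i + k) 10 with hlt | heq | hgt; (simp [hlt, hlt.ne, not_lt.2 hlt.le, pow_add]; ring); (simp only [heq, lt_irrefl, if_false, if_true, zero_add]; rw [show (256 : ℕ) ^ 10 = 256 ^ i * 256 ^ k by rw [← pow_add, heq]]; ring); (simp only [not_lt.2 hgt.le, hgt.ne', hgt, if_false, if_true, zero_add]; rw [show ext f (10 - i) * 256 ^ i * (ext f' k * 256 ^ k) = ext f (10 - i) * ext f' k * (256 ^ (i + k - 11) * 256 ^ 11) by rw [← pow_add, show i + k - 11 + 11 = i + k by omega, pow_add]; ring]; ring)); simp_rw [hsplit, sum_add_distrib, ← sum_mul]; set L := ∑ i ∈ range 11, ∑ k ∈ range 11, if i + k < 10 then ext f (10 - i) * ext f' k * 256 ^ (i + k) else 0; set M := ∑ i ∈ range 11, ∑ k ∈ range 11, if i + k = 10 then ext f (10 - i) * ext f' k else 0; set Hh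 := ∑ i ∈ range 11, ∑ k ∈ range 11, if 10 < i + k then ext f (10 - i) * ext f' k * 256 ^ (i + k - 11) else 0; have hL : L < 256 ^ 10 := (by refine lt_of_le_of_lt ?_ lowC_lt; rw [mul_sum]; apply sum_le_sum; intro i _; rw [mul_sum]; apply sum_le_sum; intro k _; split_ifs; (exact Nat.mul_le_mul_right _ (Nat.mul_le_mul (hA i) (hB k))); (exact le_refl _)); have hM : M = 12 := (by rw [← h]; have : M = ∑ i ∈ range 11, ext f (10 - i) * ext f' (10 - i) := (by apply sum_congr rfl; intro i hi; have hi' := mem_range.1 hi; rw [show (∑ k ∈ range 11, if i + k = 10 then ext f (10 - i) * ext f' k else 0) = ∑ k ∈ range 11, if 10 - i = k then ext f (10 - i) * ext f' k else 0 by apply sum_congr rfl; intro k _; congr 1; simp only [eq_iff_iff]; omega]; rw [sum_ite_eq]; simp only [mem_range, show 10 - i < 11 by omega, if_true]); rw [this, sum_range_reflect (fun i => ext f i * ext f' i) 11, Finset.sum_range (fun i => ext f i * ext f' i)]; apply Finset.sum_congr rfl; intro t _; rw [ext_of_lt f t.2, ext_of_lt f' t.2]); rw [show L + (M * 256 ^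 10 + Hh * 256 ^ 11) = L + 256 ^ 10 * (M + 256 * Hh) by ring, Nat.add_mul_div_left _ _ (by positivity), Nat.div_eq_of_lt hL, zero_add, Nat.add_mul_mod_self_left, hM]
/-- the constant-`128` packing: its bits are the bits `8k + 7`, `k < n` -/
theorem testBit_pack128 (n j : ℕ) : (pack (fun _ => 128) n).testBit j = (decide (j / 8 < n) && decide (j % 8 = 7)) := by rw [testBit_pack (fun _ _ => by norm_num)]; have h8 : ∀ b < 8, Nat.testBit 128 b = decide (b = 7) := (by decide); split_ifs with h; (rw [h8 _ (Nat.mod_lt _ (by norm_num))]; simp [h]); (simp [h])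
/-- fields below `128` have no bit `7`: masking with the `128`s gives `0` -/
theorem land_pack128_eq_zero {F : ℕ → ℕ} {n : ℕ} (hF : ∀ i < n, F i < 128) : Nat.land (pack F n) (pack (fun _ => 128) n) = 0 := by apply Nat.eq_of_testBit_eq; intro j; rw [Shape13.land_def, Nat.testBit_land, Nat.zero_testBit, testBit_pack (fun i hi => by have := hF i hi; omega), testBit_pack128]; split_ifs with h; (by_cases hb : j % 8 = 7; (rw [hb, testBit_eq_false_of_lt_le (n := 7) (hF _ h) le_rfl]; simp); (simp [hb])); (simp)
/-- fields in `[128, 256)` all have bit `7`: masking with the `128`s gives the `128`s -/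
theorem land_pack128_eq_self {F : ℕ → ℕ} {n : ℕ} (hF : ∀ i < n, 128 ≤ F i ∧ F i < 256) : Nat.land (pack F n) (pack (fun _ => 128) n) = pack (fun _ => 128) n := by apply Nat.eq_of_testBit_eq; intro j; rw [Shape13.land_def, Nat.testBit_land, testBit_pack (fun i hi => (hF i hi).2), testBit_pack128]; split_ifs with h; (by_cases hb : j % 8 = 7; (have h7 : (F (j / 8)).testBit 7 = true := (by rw [Nat.testBit_eq_decide_div_mod_eq]; obtain ⟨h1, h2⟩ := hF _ h; have : F (j / 8) / 2 ^ 7 = 1 := (by apply Nat.div_eq_of_lt_le <;> omega); rw [this]; decide); rw [hb, h7]; simp [h]); (simp [hb])); (simp [h])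
/-- **column sums at most `12` pass `colLeOK`** -/
theorem colLeOK_pack {c : ℕ → ℕ} (hc : ∀ a < 11, c a ≤ 12) : colLeOK (pack c 11) = true := by unfold colLeOK; rw [show K12 = pack (fun _ => 115) 11 by decide +kernel, show H11 = pack (fun _ => 128) 11 by decide +kernel, pack_add, Shape13.beq_eq_decide, decide_eq_true_eq]; exact land_pack128_eq_zero fun a ha => (by have := hc a ha; omega)
/-- **completable column sums pass `colDoneOK`**: with `left ≤ 2` rows to come, every column sum is at least `12 − 4·left` -/
theorem colDoneOK_pack {c : ℕ → ℕ} {left : ℕ} (hc : ∀ a < 11, c a ≤ 12) (hge : left ≤ 2 → ∀ a < 11, 12 - 4 * left ≤ c a) : colDoneOK (pack c 11) left = true := by unfold colDoneOK; rw [Bool.or_eq_true, Shape13.ble_eq_decide, decide_eq_true_eq]; by_cases hl : 3 ≤ left; (exact Or.inl hl); (right; have hl2 : left ≤ 2 := (by omega); have hK : KL left = pack (fun _ => 128 - (12 - 4 * left)) 11 := (by interval_cases left <;> decide +kernel); rw [hK, show H11 = pack (fun _ => 128) 11 by decide +kernel, pack_add, Shape13.beq_eq_decide, decide_eq_true_eq];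 exact land_pack128_eq_self fun a ha => (by have := hc a ha; have := hge hl2 a ha; omega))
/-- **partial column Gram entries within bounds pass `gramOK`** (`24` on the diagonal, `12` off it) -/
theorem gramOK_pack {γ : ℕ → ℕ} (hγ : ∀ i < 121, γ i ≤ if i % 11 = i / 11 then 24 else 12) : gramOK (pack γ 121) = true := by unfold gramOK; rw [show KG = pack (fun i => bif Nat.beq (i % 11) (i / 11) then 103 else 115) 121 by decide +kernel, show HG = pack (fun _ => 128) 121 by decide +kernel, pack_add, Shape13.beq_eq_decide, decide_eq_true_eq]; refine land_pack128_eq_zero fun i hi => ?_; have := hγ i hi; rw [Shape13.beq_eq_decide]; by_cases h : i % 11 = i / 11; (rw [if_pos h] at this; simp only [h, decide_true, cond_true]; omega); (rw [if_neg h] at this; simp only [h, decide_false, cond_false]; omega)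
/-- the bits of `geOf`: bit `k` says `d_{k+1} ≤ d_k` -/
theorem testBit_geOf : ∀ (l : List ℕ) (k : ℕ), (geOf l).testBit k = true ↔ k + 1 < l.length ∧ l.getD (k + 1) 0 ≤ l.getD k 0 | [], k => (by simp [geOf]) | [d], k => (by simp [geOf]) | d :: d' :: ds, 0 => (by rw [geOf, Nat.testBit_zero]; simp only [List.length_cons, List.getD_cons_succ, List.getD_cons_zero, decide_eq_true_eq]; cases h : Nat.ble d' d; (simp only [cond_false, zero_add, Nat.mul_mod_right]; rw [Shape13.ble_eq_decide] at h; simp at h; constructor; (intro e; exact absurd e (by norm_num)); (intro ⟨_, e⟩; omega)); (simp only [cond_true]; rw [Shape13.ble_eq_decide, decide_eq_true_eq] at h; constructor; (intro; exact ⟨by omega, h⟩); (intro; omega))) | d :: d' :: ds, k + 1 => (by rw [geOf, Nat.testBit_succ, show ((bif Nat.ble d' d then 1 else 0) + 2 * geOf (d' :: ds)) / 2 = geOf (d' :: ds) by cases Nat.ble d' d <;> simp; omega, testBit_geOf (d' :: ds) k]; simp only [List.length_cons, List.getD_cons_succ]; omega)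
/-- the bits of `gtOf`: bit `k` says `d_{k+1} < d_k` -/
theorem testBit_gtOf : ∀ (l : List ℕ) (k : ℕ), (gtOf l).testBit k = true ↔ k + 1 < l.length ∧ l.getD (k + 1) 0 < l.getD k 0 | [], k => (by simp [gtOf]) | [d], k => (by simp [gtOf]) | d :: d' :: ds, 0 => (by rw [gtOf, Nat.testBit_zero]; simp only [List.length_cons, List.getD_cons_succ, List.getD_cons_zero, decide_eq_true_eq]; cases h : Nat.blt d' d; (simp only [cond_false, zero_add, Nat.mul_mod_right]; rw [Shape13.blt_eq_decide] at h; simp at h; constructor; (intro e; exact absurd e (by norm_num)); (intro ⟨_, e⟩; omega)); (simp only [cond_true]; rw [Shape13.blt_eq_decide, decide_eq_true_eq] at h; constructor; (intro; exact ⟨by omega, h⟩); (intro; omega))) | d :: d' :: ds, k + 1 => (by rw [gtOf, Nat.testBit_succ, show ((bif Nat.blt d' d then 1 else 0) + 2 * gtOf (d' :: ds)) / 2 = gtOf (d' :: ds) by cases Nat.blt d' d <;> simp; omega, testBit_gtOf (d' :: ds) k]; simp only [List.length_cons, List.getD_cons_succ]; omega)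
/-- entries of a tabulated list -/
theorem getD_ofFn (f : Fin 11 → ℕ) (k : ℕ) : (List.ofFn f).getD k 0 = ext f k := by rw [List.getD_eq_getElem?_getD, List.getElem?_ofFn, ext]; split_ifs with h <;> simp
/-- the `ge` bits of a row function -/
theorem testBit_ge_rowR (f : Fin 11 → ℕ) (k : ℕ) : (rowR f).ge.testBit k = true ↔ ∃ h : k + 1 < 11, f ⟨k + 1, h⟩ ≤ f ⟨k, by omega⟩ := by show (geOf (List.ofFn f)).testBit k = true ↔ _; rw [testBit_geOf, List.length_ofFn, getD_ofFn, getD_ofFn]; constructor; (rintro ⟨h, e⟩; rw [ext_of_lt f h, ext_of_lt f (by omega)] at e; exact ⟨h, e⟩); (rintro ⟨h, e⟩; rw [ext_of_lt f h, ext_of_lt f (by omega)]; exact ⟨h, e⟩)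
/-- the `gt` bits of a row function -/
theorem testBit_gt_rowR (f : Fin 11 → ℕ) (k : ℕ) : (rowR f).gt.testBit k = true ↔ ∃ h : k + 1 < 11, f ⟨k + 1, h⟩ < f ⟨k, by omega⟩ := by show (gtOf (List.ofFn f)).testBit k = true ↔ _; rw [testBit_gtOf, List.length_ofFn, getD_ofFn, getD_ofFn]; constructor; (rintro ⟨h, e⟩; rw [ext_of_lt f h, ext_of_lt f (by omega)] at e; exact ⟨h, e⟩); (rintro ⟨h, e⟩; rw [ext_of_lt f h, ext_of_lt f (by omega)]; exact ⟨h, e⟩)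
/-- **tied pairs that do not increase pass `tieOK`** -/
theorem tieOK_rowR {tied : ℕ} {f : Fin 11 → ℕ} (h : ∀ k (hk : k + 1 < 11), tied.testBit k = true → f ⟨k + 1, hk⟩ ≤ f ⟨k, by omega⟩) : tieOK tied (rowR f).ge = true := by unfold tieOK; rw [Shape13.beq_eq_decide, decide_eq_true_eq]; apply Nat.eq_of_testBit_eq; intro k; rw [Shape13.land_def, Shape13.xor_def, Nat.testBit_land, Nat.testBit_xor, Nat.zero_testBit, show (1023 : ℕ) = 2 ^ 10 - 1 from rfl, Nat.testBit_two_pow_sub_one]; by_cases hk : k + 1 < 11; (cases ht : tied.testBit k; (rfl); (have := (testBit_ge_rowR f k).2 ⟨hk, h k hk ht⟩; rw [this]; simp [show k < 10 by omega])); (have hge : (rowR f).ge.testBit k = false := (by cases e : (rowR f).ge.testBit k; (rfl); (exact absurd ((testBit_ge_rowR f k).1 e).1 hk)); rw [hge]; simp [show ¬ k < 10 by omega])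
/-- the pairs tied after a row: tied before, and not decreasing on the row -/
theorem testBit_newTied {tied : ℕ} {f : Fin 11 → ℕ} {k : ℕ} (h : (newTied tied (rowR f).gt).testBit k = true) : tied.testBit k = true ∧ ∀ hk : k + 1 < 11, ¬ f ⟨k + 1, hk⟩ < f ⟨k, by omega⟩ := by unfold newTied at h; rw [Shape13.land_def, Shape13.xor_def, Nat.testBit_land, Nat.testBit_xor, show (1023 : ℕ) = 2 ^ 10 - 1 from rfl, Nat.testBit_two_pow_sub_one, Bool.and_eq_true] at h; refine ⟨h.1, fun hk hlt => ?_⟩; have := (testBit_gt_rowR f k).2 ⟨hk, hlt⟩; rw [this] at h; simp [show k < 10 by omega] at h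
/-- what the search uses about the orbit matrix of valid doubly lexical lift data -/
structure TrueMat (m : Fin 11 → Fin 11 → ℕ) : Prop where
  /-- entries at most `4` -/
  le4 : ∀ s t, m s t ≤ 4
  /-- row sums -/
  row : ∀ s, ∑ t, m s t = 12
  /-- row sums of squares -/
  rowsq : ∀ s, ∑ t, m s t * m s t = 24
  /-- inner products of distinct rows -/
  cross : ∀ s s', s ≠ s' → ∑ t, m s t * m s' t = 12
  /-- column sums -/
  col : ∀ t, ∑ s, m s t = 12
  /-- column sums of squares -/
  colsq : ∀ t, ∑ s, m s t * m s t = 24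
  /-- inner products of distinct columns -/
  colx : ∀ t t', t ≠ t' → ∑ s, m s t * m s t' = 12
  /-- rows packed are numerically decreasing -/
  rows : ∀ s s' : Fin 11, s < s' → (rowR (m s')).v < (rowR (m s)).v
  /-- adjacent columns tied above a row do not increase on it -/
  cols : ∀ (k : ℕ) (hk : k + 1 < 11) (d : Fin 11), (∀ s : Fin 11, s < d → m s ⟨k + 1, hk⟩ = m s ⟨k, by omega⟩) → m d ⟨k + 1, hk⟩ ≤ m d ⟨k, by omega⟩
/-- row `s` as a function, the zero row beyond `11` -/
def mN (m : Fin 11 → Fin 11 → ℕ) (s : ℕ) : Fin 11 → ℕ := fun t => if h : s < 11 then m ⟨s, h⟩ t else 0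
/-- `mN` below `11` -/
theorem mN_of_lt (m : Fin 11 → Fin 11 → ℕ) {s : ℕ} (h : s < 11) : mN m s = m ⟨s, h⟩ := by funext t; exact dif_pos h
/-- the chosen `v`'s after `d` true rows, last first -/
def chosenOf (m : Fin 11 → Fin 11 → ℕ) : ℕ → List ℕ | 0 => [] | d + 1 => (rowR (mN m d)).v :: chosenOf m d
/-- **the key of the orbit matrix**: `Σ_s v_s 2^(88(10−s))`, i.e. `Σ_{s,t} m_{s,t} 256^(11(10−s)+(10−t))` -/
def keyM (m : Fin 11 → Fin 11 → ℕ) : ℕ := keyOf (chosenOf m 11)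
/-- the search invariant at a state: true rows chosen so far, packed sums, ties, and sorted complete candidates -/
structure Inv (m : Fin 11 → Fin 11 → ℕ) (st : St) : Prop where
  /-- at most `11` rows -/
  dle : st.depth ≤ 11
  /-- the chosen rows are the true rows -/
  chosen : st.chosen = chosenOf m st.depth
  /-- packed column sums -/
  cs : st.cs = ∑ s ∈ range st.depth, (rowR (mN m s)).rv
  /-- packed partial column Gram matrix -/
  G : st.G = ∑ s ∈ range st.depth, (rowR (mN m s)).g
  /-- tied pairs are tied on the chosen rows -/
  tied : ∀ (k : ℕ) (hk : k + 1 < 11), st.tied.testBit k = true → ∀ s : Fin 11, (s : ℕ) < st.depth → m s ⟨k + 1, hk⟩ = m s ⟨k, by omega⟩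
  /-- candidates strictly decreasing -/
  sorted : st.cands.Pairwise fun a b => b.v < a.v
  /-- every later true row is a candidate -/
  complete : ∀ s : Fin 11, st.depth ≤ s → rowR (m s) ∈ st.cands
/-- what a (sub-)run establishes about its start state: for every true matrix satisfying the invariant there, the key is listed -/
def GoodSt (SOLS : List ℕ) (st : St) : Prop := ∀ m : Fin 11 → Fin 11 → ℕ, TrueMat m → Inv m st → memKey (keyM m) SOLS = true
/-- a chunk `[a, a + len)` of the expansion of `st` is GOOD: if the true next row sits at an index in the chunk, the key is listed -/
def GoodChunk (SOLS : List ℕ) (st : St) (a len : ℕ) : Prop := ∀ m : Fin 11 → Fin 11 → ℕ, TrueMat m → Inv m st → ∀ (pre rest : List Row) (hd : st.depth < 11), st.cands = pre ++ rowR (m ⟨st.depth, hd⟩) :: rest → a ≤ pre.length → pre.length < a + len → memKey (keyM m) SOLS = true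

end Om13

end Summit.Ventures.DiscreteObjects.PP12
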